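import Summits.QuantumFields.BalabanUV.Beta.GAN24.BlockFluxTower
import Summits.QuantumFields.BalabanUV.Beta.GAN24.LayerLetterPsi

/-!
# `BalabanUV.Beta.GAN24.BlockFluxLocal` — binder row G-an2-4 ∕ (CONV-C), CT-W (route «WC-TL» ∕ (Q-R) «QR-LL», located scalar K-LL-4′): **THE FLUX RECURSION IN THE
# END's LOCALISED CURRENCY — PER LEVEL ONE KERNEL-ONLY CONSTANT, AND THE LOCALITY RATE IS SELF-REPRODUCING BECAUSE THE COARSE READ MULTIPLIES IT BY THE BLOCKING**
# (`BiLoc` at a pair of labels: if the input letter's flux through the refinement `U_N(T)` is bi-localised at the fine points `(N•p′, N•q′)` with constant `C_Φ` and rate `δ`,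
# the pushed letter's flux through `T` is bi-localised at `(p′, q′)` with constant `|c_H|·|Fib d|²·C_K²·Z_{δ∕4}²·C_Φ` and rate `N·δ∕2` IN COARSE UNITS — leaf-04's sharp
# dilated read `T2RecursionAffine.biLoc_mmRead_dilate`; so for EVERY blocking `N ≥ 2` the rate `δ` reproduces level after level and the `k`-fold constant is a PRODUCT of kernel-only
# scalars; sequel of `GAN24/BlockFluxRegion` ∕ `GAN24/BlockFluxTower`; G-an2-4 formalisation swarm → CRUX TEAM (2), leaf prover `b2b-balaban-gan24-formalise-leaf-03`,
# gen 62, programme «FLUX-REC» PART 3; module name PROVISIONAL — the row owner gan24-p1 may rename ∕ re-home it)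

NOT IN PRINT; OUR BOOKKEEPING.  HONEST FRAMING (cell contract, verbatim): «discharging `BetaPertH` makes Bałaban's UV stability
UNCONDITIONAL — a real constructive-QFT result; it is NOT the continuum limit and NOT the Clay problem.»  HONEST DEPENDENCY (verbatim):
«continuum YM on T⁴ ⇐ BetaPertH ∧ nine spine estimates (0/9 proved); BetaPertH ⇐ (D1) ∧ (D4) ∧ CAP+tail; G-an2-4 gates asym, D1 and
NE2/3/4.»

WHAT ([folklore] `BiLoc` calculus BY NAME: `ExpKernelCalculus.biLoc_comp_decays`, `BalabanStepJetsSucc.biLoc_comp_right`, leaf-04's `T2RecursionAffine.biLoc_mmRead_dilate`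
(rate `δ ↦ M·δ` under `mmRead M`), my g61 `LayerLetterPsi.biLoc_smul_abs`, `StepJetData.biLoc_weaken ∕ decays_weaken`, over PART 1's identity `regionSum_divV_e3OfK` and
PART 2's `exists_bdd_transport`; for ANY decaying packed kernel(s) (constant(s) `C`, ONE rate `δ > 0` — the input flux is taken at the same rate, weaken beforehand),
`N ≥ 1` (`N ≥ 2` for the tower), bounded letter `S`, UNDER (hH) — DISCHARGED for the comb instance; generic `d`; 0 `def`, 0 cite, 0 `def … : Prop`, 0 sorry):
* §1 **`biLoc_sandwich_dilate`** — `Decays K C δ`, `BiLoc V (N•p′) (N•q′) C_V δ` ⇒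
  `BiLoc (c • mmRead N (K ∘ V ∘ K)) p′ q′ (|c|·(|Fib d|·((|Fib d|·(C·C_V)·Z_{δ∕4})·C)·Z_{δ∕4})) (N·(δ∕2))` — the rate in COARSE units is `N∕2` times the fine rate (rates `δ ↦ 3δ∕4 ↦ δ∕2` through the two compositions, `× N` at the read).
* §2 **`biLoc_regionSum_divV_e3OfK`** — the one-push flux recursion in `BiLoc` currency: input flux through `U_N(T)` bi-localised at `(N•p′, N•q′)` ⇒ output flux
  through `T` bi-localised at `(p′, q′)`, constant `|c_H|·|Fib d|²·C²·Z_{δ∕4}²·C_Φ`, rate `N·δ∕2`; `biLoc_regionSum_divV_e3OfK_sameRate` (`2 ≤ N`: rate `δ` again).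
* §3 **`biLoc_regionSum_divV_transport`** — the `k`-fold version (`2 ≤ N`, kernels `K_j` with constants `C_j` at the common rate `δ`, scalars `c_j`, (hH)_j): bottom flux
  through `U_{N^k}(T)` bi-localised at `(N^k•p′, N^k•q′)` with `(C_Φ, δ)` ⇒ level-`(m+k)` flux through `T` bi-localised at `(p′, q′)` with
  `((∏_{i<k} g_{m+i})·C_Φ, δ)`, `g_j := |c_j·c_{H,j}|·|Fib d|²·C_j²·Z_{δ∕4}²` — PER LEVEL ONE KERNEL-ONLY SCALAR, THE RATE LEVEL-FREE.
* §4 comb instance `biLoc_regionSum_divV_e3OfK_comb` (`K♮ᴱ_j`, `c_H = (Lc^{d+1})⁻¹`; its decay data `∃ δ C` per level by `decays_coDressKBmAt_KInvStep` — DISPLAYED).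

LOCATED CAVEAT (as in PARTs 1–2, leaf-01 g67 R-1): the constants `C_j, δ` of the literal's kernels in the END's `unitS` currency, and the input constant `C_Φ` of a
face-extended letter, are where any `Lc`-power lives; this file fixes the SHAPE (one scalar per level, rate reproduced by the dilated read), not the SIZE.  Asserts NO size of
`ρ_Φ`; decides nothing about (Q-R) ∕ (DIV) ∕ K-LL-4′; discharges NOTHING of «T2Shape» ∕ «T2Drift» ∕ (hW, hWall) ∕ (LT) ∕ (LAY) ∕ (S); 0 wall binders; NEVER «G-an2-4 closed»
as (CONV-C); NOT D1, NOT `BetaPertH`, NOT continuum, NOT Clay; not in print — our bookkeeping.  Unit `b2b-balaban-gan24-formalise-leaf-03` (gen 62), 2026-08-22.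
-/

noncomputable section

open Finset
open scoped BigOperators
open Literature.MathematicalPhysics.QuantumFieldTheory
open Literature.MathematicalPhysics.QuantumFieldTheory.Balaban1983to89
open Literature.MathematicalPhysics.QuantumFieldTheory.Balaban1983to89.Beta
open B6BondElimination (unitVec)
open ExpKernelCalculus (MKer Site Decays BiLoc comp Zl biLoc_comp_decays)
open OneStepResolventKernel (Fib)
open OneStepKernelFamily (colH KInvStep)
open BalabanStepJetsSucc (mmRead biLoc_comp_right)
open StepJetData (biLoc_weaken decays_weaken)
open KernelWard (divV Bdd)
open AffineAveraging (box toSite)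
open Summit.QuantumFields.BalabanUV.Beta.KernelWardRelative (gaugeWt)
open Summit.QuantumFields.BalabanUV.Beta.SpineRooted (e3OfK)
open Summit.QuantumFields.BalabanUV.Beta.GAN24.T2RecursionAffine (biLoc_mmRead_dilate)
open Summit.QuantumFields.BalabanUV.Beta.GAN24.LayerLetterPsi (biLoc_smul_abs)
open Summit.QuantumFields.BalabanUV.Beta.GAN24.AffineUnroll (transport transport_zero transport_succ)
open Summit.QuantumFields.BalabanUV.Beta.GAN24.E3SlotDivergence (divV_smul_family)
open Summit.QuantumFields.BalabanUV.Beta.GAN24.LayerLetterUnion (biUnion_box_image_eq)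
open Summit.QuantumFields.BalabanUV.Beta.GAN24.BlockFluxRegion (regionSum_divV_e3OfK)
open Summit.QuantumFields.BalabanUV.Beta.GAN24.BlockFluxTower (exists_bdd_transport regionSum_divV_transport)
open Summit.QuantumFields.BalabanUV.Beta.GAN24.Lin4SlotDivergence (hH_unitK_comb)
open Summit.QuantumFields.BalabanUV.Beta.HessKerDressedUnits (unitK decays_unitK)
open Summit.QuantumFields.BalabanUV.Beta.GAN24.CombesThomas (sfStep smStep)
open Summit.QuantumFields.BalabanUV.Beta.AxialDressingRooted (coDressKBmAt one_le_of_neZero decays_coDressKBmAt_KInvStep)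

namespace Summit.QuantumFields.BalabanUV.Beta.GAN24.BlockFluxLocal

variable {d N : ℕ}

/-! ## §1 The scaled sandwich read at dilated points: one kernel-only constant, rate × `N∕4` -/

/-- [folklore] **THE SCALED SANDWICH OF A BI-LOCALISED KERNEL, READ AT THE DILATED POINTS**: for `Decays K C δ` (`δ > 0`) and `BiLoc V (N•p′) (N•q′) C_V δ`,
`BiLoc (c • mmRead N (K ∘ V ∘ K)) p′ q′ (|c|·(|Fib d|·((|Fib d|·(C·C_V)·Z_{δ∕4})·C)·Z_{δ∕4})) (N·(δ∕4))` — two compositions halve the rate twice (`biLoc_comp_decays`,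
`biLoc_comp_right`), the read at blocking `N` MULTIPLIES it by `N` in coarse units (leaf-04's `biLoc_mmRead_dilate`), the scalar scales the constant (`biLoc_smul_abs`). -/
theorem biLoc_sandwich_dilate {K V : MKer (d + 1) (Fib d)} {C CV δ : ℝ} (hK : Decays K C δ) (hδ : 0 < δ) {p' q' : Site (d + 1)}
    (hV : BiLoc V ((N : ℤ) • p') ((N : ℤ) • q') CV δ) (c : ℝ) :
    BiLoc (c • mmRead N (comp (comp K V) K)) p' q'
      (|c| * ((Fintype.card (Fib d) : ℝ) * (((Fintype.card (Fib d) : ℝ) * (C * CV) * Zl (d + 1) (δ / 4)) * C) * Zl (d + 1) (δ / 4)))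
      ((N : ℝ) * (δ / 2)) := by
  have h1 := biLoc_comp_decays hK hV (show (0 : ℝ) ≤ 3 * δ / 4 by linarith) (by linarith)
  rw [show δ - 3 * δ / 4 = δ / 4 by ring] at h1
  have hK2 : Decays K C (3 * δ / 4) := decays_weaken hK le_rfl (by linarith)
  have h2 := biLoc_comp_right h1 hK2 (show (0 : ℝ) ≤ δ / 2 by linarith) (by linarith)
  rw [show 3 * δ / 4 - δ / 2 = δ / 4 by ring] at h2
  have h3 := biLoc_mmRead_dilate N h2
  exact biLoc_smul_abs h3 c

/-! ## §2 The one-push flux recursion in `BiLoc` currency -/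

section OneStep

variable {K : MKer (d + 1) (Fib d)} {C δ : ℝ} {S : Fin (d + 1) → (Fin (d + 1) → ℤ) → MKer (d + 1) (Fib d)} {B : ℝ} {cH : ℝ}

/-- [folklore] **THE FLUX RECURSION, LOCALISED** (decaying `K`, `δ > 0`, `N ≥ 1`, bounded `S`, (hH) with `c_H`, any finite `T`, any pair of labels `(p′, q′)`): if the
input letter's flux through the refinement `U_N(T)` is bi-localised at the fine points `(N•p′, N•q′)` with constant `C_Φ` and rate `δ`, then the pushed letter's flux through
`T` is bi-localised at `(p′, q′)` with constant `|c_H|·(|Fib d|·((|Fib d|·(C·C_Φ)·Z_{δ∕4})·C)·Z_{δ∕4})` and rate `N·(δ∕2)` in coarse units — ONE kernel-only constant per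
level; the blocking re-sharpens the rate. -/
theorem biLoc_regionSum_divV_e3OfK (hK : Decays K C δ) (hδ : 0 < δ) (hN : 1 ≤ N) (hS : ∀ κ u x z a b, |S κ u x z a b| ≤ B)
    (hH : ∀ (y : Fin (d + 1) → ℤ) (κ' : Fin (d + 1)) (u : Fin (d + 1) → ℤ),
      ∑ μ, (colH K N μ (y - unitVec μ) κ' u - colH K N μ y κ' u) = cH * gaugeWt N y κ' u)
    (T : Finset (Site (d + 1))) {p' q' : Site (d + 1)} {CΦ : ℝ}
    (hΦ : BiLoc (∑ u ∈ T.biUnion (fun Y => (box (d + 1) N).image (fun v => (N : ℤ) • Y + toSite v)), divV S u) ((N : ℤ) • p') ((N : ℤ) • q') CΦ δ) :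
    BiLoc (∑ Y ∈ T, divV (e3OfK N K S) Y) p' q'
      (|cH| * ((Fintype.card (Fib d) : ℝ) * (((Fintype.card (Fib d) : ℝ) * (C * CΦ) * Zl (d + 1) (δ / 4)) * C) * Zl (d + 1) (δ / 4)))
      ((N : ℝ) * (δ / 2)) := by
  rw [regionSum_divV_e3OfK hK hδ hN hS hH T, ← neg_smul]
  have h := biLoc_sandwich_dilate (N := N) hK hδ hΦ (-cH)
  rw [abs_neg] at h
  exact h

/-- [folklore] **… AT THE SAME RATE** for every blocking `N ≥ 2` (`N·δ∕2 ≥ δ`, `biLoc_weaken`): the locality rate `δ` — in each level's own units — REPRODUCES under the push; the per-level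
cost is the constant alone. -/
theorem biLoc_regionSum_divV_e3OfK_sameRate (hK : Decays K C δ) (hδ : 0 < δ) (hN2 : 2 ≤ N) (hS : ∀ κ u x z a b, |S κ u x z a b| ≤ B)
    (hH : ∀ (y : Fin (d + 1) → ℤ) (κ' : Fin (d + 1)) (u : Fin (d + 1) → ℤ),
      ∑ μ, (colH K N μ (y - unitVec μ) κ' u - colH K N μ y κ' u) = cH * gaugeWt N y κ' u)
    (T : Finset (Site (d + 1))) {p' q' : Site (d + 1)} {CΦ : ℝ}
    (hΦ : BiLoc (∑ u ∈ T.biUnion (fun Y => (box (d + 1) N).image (fun v => (N : ℤ) • Y + toSite v)), divV S u) ((N : ℤ) • p') ((N : ℤ) • q') CΦ δ) :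
    BiLoc (∑ Y ∈ T, divV (e3OfK N K S) Y) p' q'
      (|cH| * ((Fintype.card (Fib d) : ℝ) * (((Fintype.card (Fib d) : ℝ) * (C * CΦ) * Zl (d + 1) (δ / 4)) * C) * Zl (d + 1) (δ / 4))) δ := by
  have hN : 1 ≤ N := le_trans (by norm_num) hN2
  have hN2' : (2 : ℝ) ≤ (N : ℝ) := by exact_mod_cast hN2
  refine biLoc_weaken (biLoc_regionSum_divV_e3OfK hK hδ hN hS hH T hΦ) le_rfl ?_
  nlinarith

end OneStep

/-! ## §3 The tower in `BiLoc` currency: a product of kernel-only scalars, the rate level-free -/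

section Tower

variable {K : ℕ → MKer (d + 1) (Fib d)} {C : ℕ → ℝ} {δ : ℝ} {c cH : ℕ → ℝ}
  {S : Fin (d + 1) → (Fin (d + 1) → ℤ) → MKer (d + 1) (Fib d)} {B : ℝ}

/-- [folklore] **THE FLUX TOWER, LOCALISED** (kernels `K_j` with constants `C_j` at ONE rate `δ > 0` in each level's own units, scalars `c_j`, bounded bottom
letter `S`, (hH)_j with `c_{H,j}`, `N ≥ 2`; every `m, k`, finite `T`, labels `(p′, q′)`): if the bottom letter's flux through `U_{N^k}(T)` is bi-localised at `(N^k•p′, N^k•q′)` with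
`(C_Φ, δ)`, then the flux of `transport (j S ↦ c_j • e3OfK N K_j S) m k S` through `T` is bi-localised at `(p′, q′)` with constant `(∏_{i<k} g_{m+i})·C_Φ` and the SAME rate
`δ`, `g_j := |c_j·c_{H,j}|·(|Fib d|·((|Fib d|·C_j·Z_{δ∕4})·C_j)·Z_{δ∕4})` — per level ONE kernel-only scalar; no layer count enters the map (it can enter only through
`C_Φ` and the `C_j`, as displayed). -/
theorem biLoc_regionSum_divV_transport (hK : ∀ j, Decays (K j) (C j) δ) (hδ : 0 < δ) (hN2 : 2 ≤ N)
    (hS : ∀ κ u x z a b, |S κ u x z a b| ≤ B)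
    (hH : ∀ (j : ℕ) (y : Fin (d + 1) → ℤ) (κ' : Fin (d + 1)) (u : Fin (d + 1) → ℤ),
      ∑ μ, (colH (K j) N μ (y - unitVec μ) κ' u - colH (K j) N μ y κ' u) = cH j * gaugeWt N y κ' u)
    (m : ℕ) : ∀ (k : ℕ) (T : Finset (Site (d + 1))) (p' q' : Site (d + 1)) (CΦ : ℝ),
    BiLoc (∑ u ∈ T.biUnion (fun Y => (box (d + 1) (N ^ k)).image (fun v => ((N ^ k : ℕ) : ℤ) • Y + toSite v)), divV S u)
      (((N ^ k : ℕ) : ℤ) • p') (((N ^ k : ℕ) : ℤ) • q') CΦ δ →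
    BiLoc (∑ Y ∈ T, divV (transport (fun j S => c j • e3OfK N (K j) S) m k S) Y) p' q'
      ((∏ i ∈ Finset.range k, (|c (m + i) * cH (m + i)| * ((Fintype.card (Fib d) : ℝ)
          * (((Fintype.card (Fib d) : ℝ) * C (m + i) * Zl (d + 1) (δ / 4)) * C (m + i)) * Zl (d + 1) (δ / 4)))) * CΦ) δ
  | 0, T, p', q', CΦ, hΦ => by
    have hN : 1 ≤ N := le_trans (by norm_num) hN2
    rw [regionSum_divV_transport hK (fun _ => hδ) hN hS hH m 0 T, transport_zero, Finset.prod_range_zero, one_mul]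
    simpa only [pow_zero, Nat.cast_one, one_smul] using hΦ
  | k + 1, T, p', q', CΦ, hΦ => by
    classical
    have hN : 1 ≤ N := le_trans (by norm_num) hN2
    have hN2' : (2 : ℝ) ≤ (N : ℝ) := by exact_mod_cast hN2
    obtain ⟨B', hB'⟩ := exists_bdd_transport hK (fun _ => hδ) c N hS m k
    have hNk : 1 ≤ N ^ k := Nat.one_le_pow _ _ (Nat.pos_of_ne_zero (Nat.one_le_iff_ne_zero.1 hN))
    have e2 : (T.biUnion (fun Y => (box (d + 1) N).image (fun v => (N : ℤ) • Y + toSite v))).biUnion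
          (fun Y' => (box (d + 1) (N ^ k)).image (fun v => ((N ^ k : ℕ) : ℤ) • Y' + toSite v))
        = T.biUnion (fun Y => (box (d + 1) (N ^ (k + 1))).image (fun s => ((N ^ (k + 1) : ℕ) : ℤ) • Y + toSite s)) := by
      rw [Finset.biUnion_biUnion]
      refine Finset.biUnion_congr rfl fun Y _ => ?_
      rw [pow_succ]
      exact biUnion_box_image_eq hNk N Y
    -- the hypothesis on the refined region `U_N(T)` at the fine labels `(N•p′, N•q′)`
    have hpts : ∀ r : Site (d + 1), ((N ^ k : ℕ) : ℤ) • ((N : ℤ) • r) = ((N ^ (k + 1) : ℕ) : ℤ) • r := by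
      intro r
      rw [smul_smul, pow_succ, Nat.cast_mul]
    have ih : BiLoc (∑ u ∈ T.biUnion (fun Y => (box (d + 1) N).image (fun v => (N : ℤ) • Y + toSite v)),
          divV (transport (fun j S => c j • e3OfK N (K j) S) m k S) u) ((N : ℤ) • p') ((N : ℤ) • q')
        ((∏ i ∈ Finset.range k, (|c (m + i) * cH (m + i)| * ((Fintype.card (Fib d) : ℝ)
          * (((Fintype.card (Fib d) : ℝ) * C (m + i) * Zl (d + 1) (δ / 4)) * C (m + i)) * Zl (d + 1) (δ / 4)))) * CΦ) δ := by
      refine biLoc_regionSum_divV_transport hK hδ hN2 hS hH m k _ ((N : ℤ) • p') ((N : ℤ) • q') CΦ ?_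
      rw [e2, hpts, hpts]
      exact hΦ
    -- the top level: the identity, the scalar `c_{m+k}`, the localised sandwich, the rate re-sharpened and weakened back to `δ`
    have e1 : ∑ Y ∈ T, divV (c (m + k) • e3OfK N (K (m + k)) (transport (fun j S => c j • e3OfK N (K j) S) m k S)) Y
        = c (m + k) • ∑ Y ∈ T, divV (e3OfK N (K (m + k)) (transport (fun j S => c j • e3OfK N (K j) S) m k S)) Y := by
      rw [Finset.smul_sum]
      exact Finset.sum_congr rfl fun Y _ => divV_smul_family _ _ Y
    simp only [transport_succ]
    rw [e1, regionSum_divV_e3OfK (hK (m + k)) hδ hN hB' (hH (m + k)) T, smul_neg, smul_smul, ← neg_smul]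
    have h := biLoc_sandwich_dilate (N := N) (hK (m + k)) hδ ih (-(c (m + k) * cH (m + k)))
    rw [abs_neg] at h
    refine biLoc_weaken h (le_of_eq ?_) (by nlinarith)
    rw [Finset.prod_range_succ]
    ring

end Tower

/-! ## §4 The comb ∕ wall instance -/

section Comb

variable {Lc : ℕ} [NeZero Lc] {r : Fin (d + 1) → ℕ} {S : Fin (d + 1) → (Fin (d + 1) → ℤ) → MKer (d + 1) (Fib d)} {B : ℝ}

/-- [folklore] **THE COMB STEP, LOCALISED** (every `j`, in-block root, bounded `S`; the unit comb kernel's decay data `(C, δ)` DISPLAYED as a hypothesis — the tree's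
`decays_coDressKBmAt_KInvStep` supplies them `∃` per level): input flux through `U_{Lc}(T)` bi-localised at `(Lc•p′, Lc•q′)` with `(C_Φ, δ)` ⇒ output flux through `T`
bi-localised at `(p′, q′)` with constant `(Lc^{d+1})⁻¹·|Fib d|²·C²·Z_{δ∕4}²·C_Φ` and rate `Lc·δ∕4`. -/
theorem biLoc_regionSum_divV_e3OfK_comb (hr : r ∈ box (d + 1) Lc) (j : ℕ) {C δ : ℝ}
    (hK : Decays (unitK (sfStep Lc j) (smStep d Lc j) (coDressKBmAt (toSite r) Lc (KInvStep (d := d) Lc j))) C δ) (hδ : 0 < δ)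
    (hS : ∀ κ u x z a b, |S κ u x z a b| ≤ B) (T : Finset (Site (d + 1))) {p' q' : Site (d + 1)} {CΦ : ℝ}
    (hΦ : BiLoc (∑ u ∈ T.biUnion (fun Y => (box (d + 1) Lc).image (fun v => (Lc : ℤ) • Y + toSite v)), divV S u) ((Lc : ℤ) • p') ((Lc : ℤ) • q') CΦ δ) :
    BiLoc (∑ Y ∈ T, divV (e3OfK Lc (unitK (sfStep Lc j) (smStep d Lc j) (coDressKBmAt (toSite r) Lc (KInvStep (d := d) Lc j))) S) Y) p' q'
      (|((Lc : ℝ) ^ (d + 1))⁻¹| * ((Fintype.card (Fib d) : ℝ) * (((Fintype.card (Fib d) : ℝ) * (C * CΦ) * Zl (d + 1) (δ / 4)) * C) * Zl (d + 1) (δ / 4)))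
      ((Lc : ℝ) * (δ / 2)) :=
  biLoc_regionSum_divV_e3OfK hK hδ (one_le_of_neZero Lc) hS (hH_unitK_comb hr j) T hΦ

end Comb

end Summit.QuantumFields.BalabanUV.Beta.GAN24.BlockFluxLocal

end
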